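import Summits.ABC.StewartYu.PadicG3OneSched
import Summits.ABC.StewartYu.PadicG3ParF
import HarnessLib

/-!
# Cell abc-stewartyu, crux `Y07Odd` (stmt-ABC-19658), `m ≥ 1` branch: record arithmetic of the v1 family in the unit `Z = G·X·L`
# (PART A, file 2a — the `P`-letter half of the sizes)

`Summits/ABC/StewartYu/PadicG3OneSizesA.lean` — cell `abc-stewartyu` (seat p1-g8; route-holder split 2026-08-27T05:41:03Z).
Theorems only, no named fact.  With `Z := G·X·L` of the v1 family `PadicG3Par` (`PadicG3ParB/D`):
* record arithmetic: `(n+1)L ≤ Z/64`, `(n+1)L·H ≤ Z/64`, `X·L ≤ Z/(8(n+1))`, `W_L ≤ H + 1`, `2·log n ≤ n/2 + 4/5 ≤ (3/20)·H`, `H ≥ (9/2)(n+1) − 1`,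
  the `Y₀`-line `L₀·(1 + log(1+u)) ≤ Z/4 + yload` for `u ≤ 9·2^{Ŝ+n}`, `L₀·(G+1) ≤ Z/4 + G + 1`, `(m+½)·log p = G` at `θ₀ = ½`;
* `Σ Aⱼ ≤ n·Amax ≤ Z/128` (`W ≤ Z/64` is p5's `PadicG3OneExpLines.W_le_Z`).
The `G3Setup`-level sizes of p2's closed forms at `P.sched1b b` follow in `PadicG3OneSizes` (file 2b).

WHAT THIS IS NOT: sizes of p2's closed forms (file 2b), gains / `E`-lines (`PadicG3OneGain`), family lines (`PadicG3OneLines`).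

References: Yu. V. Nesterenko, LNM 1819 (2003) §3.2, §4.2 (4.24)–(4.35), §4.3; K. Yu, Acta Math. 211 (2013) §3.1.
-/

noncomputable section

open Finset Real
open Literature.NumberTheory.Transcendental

namespace Summit.ABC.StewartYu

namespace PadicG3Par

variable {n : ℕ} (P : PadicG3Par n)

/-! ### Record arithmetic in the unit `Z = G·X·L` -/

/-- `1 ≤ H`. [folklore] -/
theorem one_le_H : 1 ≤ P.H := by unfold H; exact le_max_left _ _

/-- `(n+1)·L ≤ Z/64` (`G X ≥ 64(n+1)`). [folklore] -/
theorem succ_mul_L_le_Z : ((n : ℝ) + 1) * P.L ≤ P.G * P.X * P.L / 64 := by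
  have h := P.GX_ge
  have hL : (0 : ℝ) ≤ P.L := by positivity
  rw [le_div_iff₀ (by norm_num)]
  nlinarith

/-- `(n+1)·L·H ≤ Z/64` (`H ≤ GX/(64(n+1))`). [folklore] -/
theorem succ_mul_L_mul_H_le_Z : ((n : ℝ) + 1) * P.L * P.H ≤ P.G * P.X * P.L / 64 := by
  have h := P.H_le
  have hL : (0 : ℝ) ≤ P.L := by positivity
  have hn : (0 : ℝ) < (n : ℝ) + 1 := by positivity
  have h1 : ((n : ℝ) + 1) * P.H ≤ P.G * P.X / 64 := by
    have := mul_le_mul_of_nonneg_left h hn.le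
    have e : ((n : ℝ) + 1) * (P.G * P.X / (64 * (n + 1))) = P.G * P.X / 64 := by field_simp
    linarith
  calc ((n : ℝ) + 1) * P.L * P.H = (((n : ℝ) + 1) * P.H) * P.L := by ring
    _ ≤ (P.G * P.X / 64) * P.L := mul_le_mul_of_nonneg_right h1 hL
    _ = P.G * P.X * P.L / 64 := by ring

/-- `X·L ≤ Z/(8(n+1))` (`G ≥ 8(n+1)`). [folklore] -/
theorem X_mul_L_le_Z : (P.X : ℝ) * P.L ≤ P.G * P.X * P.L / (8 * (n + 1)) := by
  have hG := P.cG_mul_le_G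
  unfold cG at hG
  have hXL : (0 : ℝ) ≤ (P.X : ℝ) * P.L := by positivity
  rw [le_div_iff₀ (by positivity)]
  nlinarith

/-- `W_L ≤ H + 1` (`64(n+1)W_L/G ≤ X` and `GX/(64(n+1)) − 1 < H`). [folklore] -/
theorem WL_le_H_add_one : P.WL ≤ P.H + 1 := by
  have h1 := P.main_le_X
  have h2 := P.H_gt
  have hG : (0 : ℝ) < P.G := by linarith [P.eight_le_G]
  have hn : (0 : ℝ) < (n : ℝ) + 1 := by positivity
  have h3 : P.WL ≤ P.G * P.X / (64 * (n + 1)) := by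
    rw [le_div_iff₀ (by positivity)]
    have := (div_le_iff₀ hG).mp h1
    nlinarith
  linarith

/-- `(9/2)(n+1) − 1 ≤ H` (`G ≥ 8(n+1)`, `X ≥ 36(n+1)`). [folklore] -/
theorem H_ge : (9 / 2 : ℝ) * (n + 1) - 1 ≤ P.H := by
  have h2 := P.H_gt
  have hG := P.cG_mul_le_G
  unfold cG at hG
  have hX := P.X_ge
  have hn : (0 : ℝ) < (n : ℝ) + 1 := by positivity
  have h3 : (9 / 2 : ℝ) * (n + 1) ≤ P.G * P.X / (64 * (n + 1)) := by
    rw [le_div_iff₀ (by positivity)]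
    have := mul_le_mul hG hX (by positivity) (by linarith)
    nlinarith
  linarith

/-- `2·log n ≤ n/2 + 4/5` (`log x ≤ x − 1` at `x = n/4`, `log 4 = 2 log 2 < 1.4`). [folklore] -/
theorem two_log_n_le : 2 * Real.log n ≤ (n : ℝ) / 2 + 4 / 5 := by
  rcases Nat.eq_zero_or_pos n with h0 | h0
  · subst h0; norm_num
  have hn : (0 : ℝ) < n := by exact_mod_cast h0
  have h := Real.log_le_sub_one_of_pos (show (0 : ℝ) < n / 4 by positivity)
  rw [Real.log_div hn.ne' (by norm_num)] at h
  have h4 : Real.log 4 = 2 * Real.log 2 := by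
    rw [show (4 : ℝ) = 2 ^ 2 by norm_num, Real.log_pow]; ring
  have h2 := Real.log_two_lt_d9
  linarith

/-- `2·log n ≤ (3/20)·H` (`H ≥ (9/2)(n+1) − 1`; `n = 1` apart). [folklore] -/
theorem two_log_n_le_H : 2 * Real.log n ≤ (3 / 20) * P.H := by
  have h2 := P.H_ge
  have hn1 := P.hn
  rcases Nat.eq_or_lt_of_le hn1 with h1 | h1
  · have hc : (n : ℝ) = 1 := by exact_mod_cast h1.symm
    rw [hc, Real.log_one, mul_zero]
    have : (1 : ℝ) ≤ n := by exact_mod_cast hn1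
    linarith
  · have h3 := two_log_n_le (n := n)
    have hn2 : (2 : ℝ) ≤ n := by exact_mod_cast h1
    linarith

/-- `1 + (Ŝ + n + 4)·log 2 ≤ yload`. [folklore] -/
theorem one_add_log_le_yload : 1 + (P.Sdepth + n + 4) * Real.log 2 ≤ P.yload := by
  unfold yload
  have hG := P.sixteen_le_G
  have hlp : 0 ≤ Real.log P.p := P.log_p_pos.le
  have hl2 : Real.log 2 ≤ 7 / 10 := by have := Real.log_two_lt_d9; linarith
  have hl20 : 0 ≤ Real.log 2 := Real.log_nonneg (by norm_num)
  have hln : 0 ≤ Real.log ((n : ℝ) + 1) := Real.log_nonneg (by have := P.hn; norm_cast; omega)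
  nlinarith

/-- **The `Y₀`-line**: `L₀·(1 + log(1 + u)) ≤ Z/4 + yload` for `0 ≤ u ≤ 9·2^{Ŝ+n}`. [cite: Nesterenko2003, (3.37)–(3.39); shape only] -/
theorem L0_line_le {u : ℝ} (hu0 : 0 ≤ u) (hu : u ≤ 9 * 2 ^ (P.Sdepth + n)) :
    (P.L₀ : ℝ) * (1 + Real.log (1 + u)) ≤ P.G * P.X * P.L / 4 + P.yload := by
  have h1 : 1 + u ≤ (2 : ℝ) ^ (P.Sdepth + n + 4) := by
    have : (2 : ℝ) ^ (P.Sdepth + n + 4) = 16 * 2 ^ (P.Sdepth + n) := by ring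
    have h1 : (1 : ℝ) ≤ 2 ^ (P.Sdepth + n) := one_le_pow₀ (by norm_num)
    nlinarith
  have h2 : Real.log (1 + u) ≤ (P.Sdepth + n + 4) * Real.log 2 := by
    calc Real.log (1 + u) ≤ Real.log ((2 : ℝ) ^ (P.Sdepth + n + 4)) := Real.log_le_log (by linarith) h1
      _ = (P.Sdepth + n + 4) * Real.log 2 := by rw [Real.log_pow]; push_cast; ring
  have h3 := P.one_add_log_le_yload
  have h4 := P.L₀_mul_yload_le
  have hL₀ : (0 : ℝ) ≤ P.L₀ := by positivity
  calc (P.L₀ : ℝ) * (1 + Real.log (1 + u)) ≤ P.L₀ * P.yload := mul_le_mul_of_nonneg_left (by linarith) hL₀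
    _ ≤ _ := h4

/-- `L₀·(G + 1) ≤ Z/4 + G + 1` (`L₀ ≤ Z/(4·yload) + 1`, `G + 1 ≤ yload`). [folklore] -/
theorem L0_mul_G_add_one_le : (P.L₀ : ℝ) * (P.G + 1) ≤ P.G * P.X * P.L / 4 + P.G + 1 := by
  have h := P.L₀_le
  have hY := P.yload_pos
  have hGY : P.G + 1 ≤ P.yload := by
    have := P.G_le_yload
    unfold yload at this ⊢
    have hlp : 0 ≤ Real.log P.p := P.log_p_pos.le
    have hl20 : 0 ≤ Real.log 2 := Real.log_nonneg (by norm_num)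
    have hln : 0 ≤ Real.log ((n : ℝ) + 1) := Real.log_nonneg (by have := P.hn; norm_cast; omega)
    nlinarith
  have hG : 0 ≤ P.G + 1 := by linarith [P.eight_le_G]
  have hZ : 0 ≤ P.G * P.X * P.L := by have := P.GXL_ge; linarith
  have h1 : (P.L₀ : ℝ) * (P.G + 1) ≤ (P.G * P.X * P.L / (4 * P.yload) + 1) * (P.G + 1) :=
    mul_le_mul_of_nonneg_right h hG
  have h2 : P.G * P.X * P.L / (4 * P.yload) * (P.G + 1) ≤ P.G * P.X * P.L / 4 := by
    rw [div_mul_eq_mul_div, div_le_div_iff₀ (by positivity) (by norm_num)]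
    nlinarith
  nlinarith

/-- `(m + ½)·log p = G` at `θ₀ = ½`. [folklore] -/
theorem half_log_eq_G (hθ : P.θ₀ = 1 / 2) : ((P.m : ℝ) + 1 / 2) * Real.log P.p = P.G := by
  unfold G θm; rw [hθ]

/-- `Σⱼ Aⱼ ≤ n·Amax ≤ n·L/2`. [folklore] -/
theorem sum_A_le : ∑ j, P.A j ≤ n * P.Amax := by
  calc ∑ j, P.A j ≤ ∑ _j : Fin n, P.Amax := sum_le_sum fun j _ => P.hAmax j
    _ = n * P.Amax := by rw [sum_const, card_univ, Fintype.card_fin, nsmul_eq_mul]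

/-- `n·Amax ≤ n·L/2 ≤ Z/128`. [folklore] -/
theorem n_mul_Amax_le_Z : (n : ℝ) * P.Amax ≤ P.G * P.X * P.L / 128 := by
  have h1 := P.two_Amax_le_L
  have h2 := P.succ_mul_L_le_Z
  have hn : (0 : ℝ) ≤ n := by positivity
  have hA : (0 : ℝ) ≤ P.Amax := by linarith [P.hAmax1]
  nlinarith

end PadicG3Par

end Summit.ABC.StewartYu

end
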